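import Literature.MathematicalPhysics.QuantumFieldTheory.Balaban1983to89.B9Eq3100LeibnizCommutatorDiv
import Literature.MathematicalPhysics.QuantumFieldTheory.Balaban1983to89.B9Eq373DerivativeRemainderL2
import Literature.MathematicalPhysics.QuantumFieldTheory.Balaban1983to89.B9Eq311PointwiseMultipliers
import Literature.MathematicalPhysics.QuantumFieldTheory.Balaban1983to89.B9Eq387IMSLocalLettersLattice
import Literature.MathematicalPhysics.QuantumFieldTheory.Balaban1983to89.B9Eq387IMSLocalLetterQprime

/-!
# `Balaban1983to89.B9Eq388KhCommutatorLattice` — T. Bałaban, *Propagators for lattice gauge theories in a background field*, Commun. Math. Phys.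
# **99** (1985) 389–434 [Balaban1985BackgroundPropagators] (3.88) p. 409 with (3.100) p. 413, (3.102)∕(3.104) p. 414: **PRINT's COMMUTATOR `K(h)` AT THE
# LATTICE — THE NEAR-FIELD LETTERS `a₁`, `a₀` (site Laplacian `D_U*D_U` against a slowly varying cutoff) AND `b₀` (the scalar averaging `Q′`)**:
# `‖D*(D(Θf)) − Θ(D*(Df))‖ ≤ √d‖c′‖θ₁(M_T + 1)·‖Df‖ + d‖c′‖‖c‖θ₂·‖f‖` for a multiplier `σ` with first∕second differences `≤ θ₁`∕`≤ θ₂`; at the tree's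
# cube function `σ = hS_z` (`θ₁ = 4∕M₀`, `θ₂ = 52∕M₀²`) and `c = c′ = η⁻¹`: `a₁ = 4√d(M_T + 1)∕(M₀η)`, `a₀ = 52d∕(M₀η)²`; and `‖T(χ_Sλ) − χ_G(Tλ)‖ ≤ M_A√Θ‖λ‖`
# (`b₀ = M_A√Θ`) — the DISPLAYED hypotheses `ha`, `hb` of route R2′ STEP B8′ S-P6′(β) (`B9Eq387CubeLocalisedProjection.norm_sub_projR_cube_le_nearfield`)
# INHABITED at the lattice, `η`-free at fixed cube side `M = M₀η`, no volume

statement-level skeleton of published theorems with citation tags; proofs where landed; nothing here is a claim about the Yang–Mills mass gap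

CITATION HEADER (lean-in-tree rule).  Audit cell `pub-balaban`, sub-cell `t4`, BINDER row NE9; filed by NE9 formalisation-swarm leaf prover 05
(`b2b-balaban-t4-ne9-formalise-leaf-05`, gen 74).  CONSUMER BY SHAPE: ne9-leaf-06's `B9Eq387CubeLocalisedProjection.norm_sub_projR_cube_le_nearfield` (§3 (β))
takes `ha : ∀ u, ‖Δs (θ u) − θ (Δs u)‖ ≤ a₁‖D u‖ + a₀‖u‖` (`Δs = D†D`) and `hb : ∀ u, ‖Q′(θ u) − θ_F(Q′ u)‖ ≤ b₀‖u‖` as DISPLAYED hypotheses («print's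
`K(h)` of (3.88) as a LETTER»); the desk priced that port «NEEDS-CONSTANT BY CONSTRUCTION: no lattice instance of `τ, c_P, a₁, a₀, b₀, C_Ψ`» (PRICING-NE9
v64∕v65).  This file supplies `a₁`, `a₀`, `b₀` (`c_P`: the cell's block Poincaré files; `C_Ψ`: `B9Eq319BumpSectionTorus` + ne9-leaf-06's plug; `τ`: the S-P5(b)
decay — NOT here).  TOOLS BY NAME: ne9-leaf-04's `B9Eq3100LeibnizCommutatorDiv`, `B9Eq373DerivativeRemainderL2.norm_le_of_sum_sq_le`, ne9-leaf-06's
`B9Eq311PointwiseMultipliers`, `B5SmoothPartition` (`abs_gS_sub_le`, `abs_hS_second_diff_le`), ne9-leaf-01's `circAbs_bond_le_one`, this lineage's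
`B9Eq3102QprimeCommutatorLettersCarrier.sum_norm_sq_comm_T_le_diagonal` and `B9Eq387IMSLocalLetterQprime.sum_hS_centre_sub_sq_le`.  Source READ in the held
text (`paper:balaban1985-cmp99-background-propagators`, journal page = PDF page + 388): p. 409 (3.88) *«(Δ′_a h_□λ)(x) = h(x)(Δ′_aλ)(x) − (K(h)λ)(x)»*;
p. 413 (3.100) *«(D_μhA_ν)(x) = h(x)(D_μA_ν)(x) + (∂_μh)(x)R(U(x, x + ηe_μ))A_ν(x + ηe_μ), similarly for adjoint derivatives, hence the commutators
[D*D, h] and [DD*, h] are first order differential operators with coefficients determined by derivatives of the function h. They are of the order O(M⁻¹),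
or O(M⁻²), if considered on a proper scale»*; p. 414 (3.104) *«Δ_a hA = hΔ_a − K(h)A − … where K(h) is a sum of a first order differential operator and …»*.
WHY.  `[D*D, θ] = [D*, θ_B]∘D + D*∘[D, θ]`; the first piece is ne9-leaf-04's divergence commutator on `Df`; the second must NOT go through `‖D*‖ = O(η⁻¹)`:
expanding `D*` on `[D, θ]f(b) = c(σ(b₊) − σ(b₋))R_bf(b₊)` with `S_b∘R_b = 1` gives a SECOND difference of `σ` times `f` plus a first difference times `Df`.
WHAT IS PROVED (sorry-free; proof lane — no `def`; [folklore] Leibniz algebra + Cauchy–Schwarz + the cell's profile letters; nothing of [B9] asserted):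
§1 `comm_covDeriv_apply`, `comm_comm_covDeriv_apply`, `lap_comm_split`, **`covDiv_comm_covDeriv_apply`**; §2 `norm_site_le_of_outstar_bound`, **`norm_lap_comm_le`**,
`norm_lap_comm_le_etaFree`; §3 `abs_hS_sub_shift_le` (`4∕M₀`), `abs_hS_bond_diff_le`, `abs_hS_second_diff_centre_le` (`52∕M₀²`); §4 **`norm_lap_comm_le_hS`**,
**`norm_lap_comm_le_hS_eta`** (`a₁ = 4√d(M_T + 1)∕(M₀η)`, `a₀ = 52d∕(M₀η)²`); §5 `norm_sq_comm_T_single_le`, **`norm_comm_T_single_le`** (`b₀ = M_A√Θ`),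
**`norm_comm_T_single_le_hS`** (`b₀ = 8√d·M_A(L − 1)∕M₀` for one cube function read at block base points).
HONEST SCOPE.  Letters of TWO displayed hypotheses of ONE sub-step (S-P6′(β)) for ONE cube function; `D_U* = D_U†` (`B11Eq103H1Complex.adjoint_covDerivL2K`
under `hRS`) is the consumer's line; `c_P`, `τ`, `C_Ψ` NOT here; NOT NE9 (cell pub-balaban: NE9 NOT PRINTED ∕ NOT PROVED; «NE9 ⇐ the named binders»; spine
PROVED 0∕9; rung (B)+1 on a finite T⁴ — NOT infinite volume, NOT mass gap, NOT Clay; HONEST DEPENDENCY: continuum YM on T⁴ ⇐ BetaPertH ∧ nine spine estimates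
(0/9 proved); BetaPertH ⇐ (D1) ∧ (D4) ∧ CAP+tail; G-an2-4 gates asym, D1 and NE2/3/4).  NEW file; nothing modified.  Net new unproved facts: 0.
-/

noncomputable section

namespace Literature.MathematicalPhysics.QuantumFieldTheory.Balaban1983to89.B9Eq388KhCommutatorLattice

open B4Sect5Torus (TSite)
open B9SectCLatticeCarrier (Bond bpos btgt shift unshift shift_unshift shift_apply_val)
open B9Eq33CovDerivVector (covDeriv covDeriv_apply covDiv covDiv_apply)
open B9Eq311L2Pairing (WL2)
open B11Eq103H1Complex (SiteL2K BondL2K covDerivL2K covDivL2K equiv_covDerivL2K equiv_covDivL2K)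
open B9Eq373DerivativeRemainderL2 (norm_le_of_sum_sq_le)
open B4TorusKernel.MultiPeriod (circAbs circAbs_nonneg)
open B5TorusCover (Ctr)
open B5SmoothPartition (hS gS hS_eq hS_update abs_gS_sub_le gS_nonneg gS_le_one abs_hS_second_diff_le)
open B9Eq387IMSLocalLettersLattice (circAbs_bond_le_one)
open B9Eq323Ker (pathTr)
open B9Eq319QprimeTorus (fineP centre contour stepTransport QprimeLin)
open B9Eq3102QprimeCommutatorLettersCarrier (sum_norm_sq_comm_T_le_diagonal)
open B9Eq387IMSLocalLetterQprime (sum_hS_centre_sub_sq_le)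

/-! ## §1 (3.100) for the gradient and the `η`-free expansion of `D*∘[D, σ]` -/
section Identity
variable {𝕜 : Type*} [CommRing 𝕜] {d : ℕ} {Pd : Fin d → ℕ} {W : Type*} [AddCommGroup W] [Module 𝕜 W]

/-- **(3.100) FOR THE GRADIENT — THE SINGLE COMMUTATOR IS A MULTIPLICATION LETTER**: `D(σf)(b) − σ(b₋)·(Df)(b) = c·(σ(b₊) − σ(b₋))·R_bf(b₊)` (the
`f(b₋)` terms cancel exactly). [folklore] (Leibniz rule) [cite: Balaban1985BackgroundPropagators, (3.100) p.413, (3.3) pp.390–391] -/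
theorem comm_covDeriv_apply (σ : TSite d Pd → 𝕜) (c : 𝕜) (R : Bond d Pd → W →ₗ[𝕜] W) (f : TSite d Pd → W) (b : Bond d Pd) :
    covDeriv c R (fun x => σ x • f x) b - σ (bpos b) • covDeriv c R f b = c • ((σ (btgt b) - σ (bpos b)) • R b (f (btgt b))) := by
  simp only [covDeriv_apply, map_smul, smul_sub]
  module

/-- **THE DOUBLE COMMUTATOR FOR THE GRADIENT — SQUARED INCREMENTS**: `ad_σ(ad_σD)f(b) = c·(σ(b₊) − σ(b₋))²·R_bf(b₊)`. [folklore] [cite: Balaban1985BackgroundPropagators, (3.100) p.413] -/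
theorem comm_comm_covDeriv_apply (σ : TSite d Pd → 𝕜) (c : 𝕜) (R : Bond d Pd → W →ₗ[𝕜] W) (f : TSite d Pd → W) (b : Bond d Pd) :
    (covDeriv c R (fun x => σ x • (σ x • f x)) b - σ (bpos b) • covDeriv c R (fun x => σ x • f x) b) -
        σ (bpos b) • (covDeriv c R (fun x => σ x • f x) b - σ (bpos b) • covDeriv c R f b) =
      c • ((σ (btgt b) - σ (bpos b)) ^ 2 • R b (f (btgt b))) := by
  simp only [covDeriv_apply, map_smul, smul_sub]
  module

/-- **`[D*D, σ] = D*∘[D, σ] + [D*, σ̃]∘D` AT THE FUNCTION LEVEL**: with the bond field `ad_σf := D(σf) − σ̃(Df)`,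
`D*(D(σf))(y) − σ(y)·D*(Df)(y) = D*(ad_σf)(y) + (D*(σ̃(Df))(y) − σ(y)·D*(Df)(y))`. [folklore] [cite: Balaban1985BackgroundPropagators, (3.88) p.409, (3.104) p.414] -/
theorem lap_comm_split [Fintype (Fin d)] (σ : TSite d Pd → 𝕜) (c c' : 𝕜) (R S : Bond d Pd → W →ₗ[𝕜] W) (f : TSite d Pd → W) (y : TSite d Pd) :
    covDiv c' S (covDeriv c R (fun x => σ x • f x)) y - σ y • covDiv c' S (covDeriv c R f) y =
      covDiv c' S (fun b => covDeriv c R (fun x => σ x • f x) b - σ (bpos b) • covDeriv c R f b) y +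
        (covDiv c' S (fun b => σ (bpos b) • covDeriv c R f b) y - σ y • covDiv c' S (covDeriv c R f) y) := by
  have h : covDiv c' S (fun b => covDeriv c R (fun x => σ x • f x) b - σ (bpos b) • covDeriv c R f b) y =
      covDiv c' S (covDeriv c R (fun x => σ x • f x)) y - covDiv c' S (fun b => σ (bpos b) • covDeriv c R f b) y := by
    have e : (fun b => covDeriv c R (fun x => σ x • f x) b - σ (bpos b) • covDeriv c R f b) =
        covDeriv c R (fun x => σ x • f x) - (fun b => σ (bpos b) • covDeriv c R f b) := rfl
    rw [e, map_sub, Pi.sub_apply]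
  rw [h]; abel

/-- **THE `η`-FREE EXPANSION OF `D*(ad_σf)`**: with `S_b∘R_b = 1`,
`D*(ad_σf)(y) = c′c·(Σ_μ (δ(y−e_μ,μ) − δ(y,μ)))·f(y) − c′·Σ_μ δ(y,μ)·(Df)(y,μ)`, `δ(b) = σ(b₊) − σ(b₋)` — a SECOND difference of `σ` times `f` plus a
first difference times `Df` («first order differential operators …»). [folklore] [cite: Balaban1985BackgroundPropagators, (3.100) p.413, (3.88) p.409, (3.104) p.414] -/
theorem covDiv_comm_covDeriv_apply [Fintype (Fin d)] (σ : TSite d Pd → 𝕜) (c c' : 𝕜) (R S : Bond d Pd → W →ₗ[𝕜] W)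
    (hSR : ∀ b v, S b (R b v) = v) (f : TSite d Pd → W) (y : TSite d Pd) :
    covDiv c' S (fun b => covDeriv c R (fun x => σ x • f x) b - σ (bpos b) • covDeriv c R f b) y =
      (c' * c) • ((∑ μ, ((σ y - σ (unshift μ y)) - (σ (shift μ y) - σ y))) • f y) -
        c' • ∑ μ, (σ (shift μ y) - σ y) • covDeriv c R f (y, μ) := by
  have e : (fun b => covDeriv c R (fun x => σ x • f x) b - σ (bpos b) • covDeriv c R f b) =
      fun b => c • ((σ (btgt b) - σ (bpos b)) • R b (f (btgt b))) := funext fun b => comm_covDeriv_apply σ c R f b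
  rw [e, covDiv_apply]
  simp only [bpos, btgt, shift_unshift, map_smul, hSR, covDeriv_apply]
  rw [Finset.sum_smul, Finset.smul_sum, Finset.smul_sum, Finset.smul_sum, ← Finset.sum_sub_distrib]
  refine Finset.sum_congr rfl fun μ _ => ?_
  module

end Identity

/-! ## §2 `L²` tools and letters -/
section L2

variable {𝕜 : Type*} [RCLike 𝕜] {d : ℕ} {Pd : Fin d → ℕ} {W : Type*} [NormedAddCommGroup W] [InnerProductSpace 𝕜 W]
  {c₀ : ℝ} [Fact (0 < c₀)]

/-- **A POINTWISE OUT-STAR BOUND GIVES AN `L²` BOUND**: `‖G(y)‖ ≤ K·Σ_μ ‖A(y, μ)‖` at every site (`0 ≤ K`) ⇒ `‖G‖ ≤ √d·K·‖A‖` (Cauchy–Schwarz over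
the `d` directions; the twin of ne9-leaf-04's in-star tool). [folklore] [cite: Balaban1985BackgroundPropagators, (3.3) p.391, (3.11) p.392] -/
theorem norm_site_le_of_outstar_bound (A : BondL2K 𝕜 d Pd c₀ W) (G : SiteL2K 𝕜 d Pd c₀ W) {K : ℝ} (hK : 0 ≤ K)
    (h : ∀ y : TSite d Pd, ‖WL2.equiv 𝕜 _ W G y‖ ≤ K * ∑ μ : Fin d, ‖WL2.equiv 𝕜 _ W A (y, μ)‖) :
    ‖G‖ ≤ Real.sqrt d * K * ‖A‖ := by
  have hc₀ : 0 < c₀ := Fact.out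
  refine norm_le_of_sum_sq_le A G (by positivity) ?_
  set a : Bond d Pd → W := WL2.equiv 𝕜 _ W A with ha
  have hpt : ∀ y : TSite d Pd, c₀ * ‖WL2.equiv 𝕜 _ W G y‖ ^ 2 ≤ K ^ 2 * d * ∑ μ : Fin d, c₀ * ‖a (y, μ)‖ ^ 2 := fun y => by
    have h1 : ‖WL2.equiv 𝕜 _ W G y‖ ^ 2 ≤ (K * ∑ μ : Fin d, ‖a (y, μ)‖) ^ 2 := by
      have := h y; gcongr
    have h2 : (∑ μ : Fin d, ‖a (y, μ)‖) ^ 2 ≤ d * ∑ μ : Fin d, ‖a (y, μ)‖ ^ 2 := by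
      have h := sq_sum_le_card_mul_sum_sq (s := (Finset.univ : Finset (Fin d))) (f := fun μ => ‖a (y, μ)‖)
      simpa using h
    rw [Finset.mul_sum]
    calc c₀ * ‖WL2.equiv 𝕜 _ W G y‖ ^ 2 ≤ c₀ * (K ^ 2 * (d * ∑ μ : Fin d, ‖a (y, μ)‖ ^ 2)) := by
          refine mul_le_mul_of_nonneg_left (h1.trans ?_) hc₀.le
          rw [mul_pow]; exact mul_le_mul_of_nonneg_left h2 (sq_nonneg _)
      _ = ∑ μ : Fin d, K ^ 2 * d * (c₀ * ‖a (y, μ)‖ ^ 2) := by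
          rw [Finset.mul_sum, Finset.mul_sum, Finset.mul_sum]; exact Finset.sum_congr rfl fun μ _ => by ring
  calc ∑ y : TSite d Pd, c₀ * ‖WL2.equiv 𝕜 _ W G y‖ ^ 2 ≤ ∑ y : TSite d Pd, K ^ 2 * d * ∑ μ : Fin d, c₀ * ‖a (y, μ)‖ ^ 2 :=
        Finset.sum_le_sum fun y _ => hpt y
    _ = K ^ 2 * d * ∑ b : Bond d Pd, c₀ * ‖a b‖ ^ 2 := by
        rw [← Finset.mul_sum, ← Fintype.sum_prod_type (f := fun b : Bond d Pd => c₀ * ‖a b‖ ^ 2)]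
    _ = (Real.sqrt d * K) ^ 2 * ∑ b : Bond d Pd, c₀ * ‖a b‖ ^ 2 := by rw [mul_pow, Real.sq_sqrt (Nat.cast_nonneg d)]; ring

variable {R S : Bond d Pd → W →ₗ[𝕜] W} {MT : ℝ}

/-- **PRINT's `K(h)` FOR THE SITE LAPLACIAN `D*D` ON THE WEIGHTED CARRIERS**: maps `Θ` (sites, acting as `σ`), `Θ_B` (bonds, acting as `σ(b₋)`),
first differences `|σ(b₋) − σ(b₊)| ≤ θ₁`, second differences `|(σ(y) − σ(y−e_μ)) − (σ(y+e_μ) − σ(y))| ≤ θ₂`, transporters `‖S_bv‖ ≤ M_T‖v‖` with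
`S_b∘R_b = 1`: `‖D*(D(Θf)) − Θ(D*(Df))‖ ≤ √d‖c′‖θ₁(M_T + 1)·‖Df‖ + d‖c′‖‖c‖θ₂·‖f‖` — the `ha` shape of
`B9Eq387CubeLocalisedProjection.norm_sub_projR_cube_le_nearfield`, `a₁ = √d‖c′‖θ₁(M_T + 1)`, `a₀ = d‖c′‖‖c‖θ₂`. [folklore] [cite: Balaban1985BackgroundPropagators, (3.88) p.409, p.413] -/
theorem norm_lap_comm_le (hMT : 0 ≤ MT) (hS : ∀ b v, ‖S b v‖ ≤ MT * ‖v‖) (hSR : ∀ b v, S b (R b v) = v)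
    {σ : TSite d Pd → ℝ} {θ₁ θ₂ : ℝ} (hθ₁ : 0 ≤ θ₁) (hθ₂ : 0 ≤ θ₂)
    (h1 : ∀ b : Bond d Pd, |σ (bpos b) - σ (btgt b)| ≤ θ₁)
    (h2 : ∀ (y : TSite d Pd) (μ : Fin d), |(σ y - σ (unshift μ y)) - (σ (shift μ y) - σ y)| ≤ θ₂)
    (Θ : SiteL2K 𝕜 d Pd c₀ W → SiteL2K 𝕜 d Pd c₀ W) (ΘB : BondL2K 𝕜 d Pd c₀ W → BondL2K 𝕜 d Pd c₀ W)
    (hΘ : ∀ (f : SiteL2K 𝕜 d Pd c₀ W) (x : TSite d Pd), WL2.equiv 𝕜 _ W (Θ f) x = (σ x : 𝕜) • WL2.equiv 𝕜 _ W f x)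
    (hΘB : ∀ (A : BondL2K 𝕜 d Pd c₀ W) (b : Bond d Pd), WL2.equiv 𝕜 _ W (ΘB A) b = (σ (bpos b) : 𝕜) • WL2.equiv 𝕜 _ W A b)
    (c c' : 𝕜) (f : SiteL2K 𝕜 d Pd c₀ W) :
    ‖covDivL2K 𝕜 c₀ c' S (covDerivL2K 𝕜 c₀ c R (Θ f)) - Θ (covDivL2K 𝕜 c₀ c' S (covDerivL2K 𝕜 c₀ c R f))‖ ≤
      Real.sqrt d * ‖c'‖ * θ₁ * (MT + 1) * ‖covDerivL2K 𝕜 c₀ c R f‖ + d * ‖c'‖ * ‖c‖ * θ₂ * ‖f‖ := by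
  set l : TSite d Pd → W := WL2.equiv 𝕜 _ W f with hl
  set Df := covDerivL2K 𝕜 c₀ c R f with hDf
  -- the bond field `ad f := D(Θf) − ΘB(Df)` and the second piece `P2 := Θ(D*(Df)) − D*(ΘB(Df))`
  set adf : BondL2K 𝕜 d Pd c₀ W := covDerivL2K 𝕜 c₀ c R (Θ f) - ΘB Df with hadf
  have hsplit : covDivL2K 𝕜 c₀ c' S (covDerivL2K 𝕜 c₀ c R (Θ f)) - Θ (covDivL2K 𝕜 c₀ c' S Df) =
      covDivL2K 𝕜 c₀ c' S adf - (Θ (covDivL2K 𝕜 c₀ c' S Df) - covDivL2K 𝕜 c₀ c' S (ΘB Df)) := by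
    rw [hadf, map_sub]; abel
  -- piece 2: leaf-04's divergence commutator letter at `A := Df`
  have hP2 : ‖Θ (covDivL2K 𝕜 c₀ c' S Df) - covDivL2K 𝕜 c₀ c' S (ΘB Df)‖ ≤ Real.sqrt d * (‖c'‖ * θ₁ * MT) * ‖Df‖ :=
    B9Eq3100LeibnizCommutatorDiv.norm_comm_covDivL2K_le ΘB Θ hMT hS hθ₁ h1 hΘB hΘ c' Df
  -- piece 1: the expansion of `D*(ad f)` — underlying functions
  have hΘf : WL2.equiv 𝕜 _ W (Θ f) = fun x => (σ x : 𝕜) • l x := funext (hΘ f)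
  have hadf_fun : WL2.equiv 𝕜 _ W adf = fun b => covDeriv c R (fun x => (σ x : 𝕜) • l x) b - (σ (bpos b) : 𝕜) • covDeriv c R l b := by
    funext b
    rw [hadf, WL2.equiv_sub, Pi.sub_apply, equiv_covDerivL2K, hΘf, hΘB, hDf, equiv_covDerivL2K]
  -- the two summands of the expansion as carrier elements (built inside the proof; no definition)
  set P1a : SiteL2K 𝕜 d Pd c₀ W := (WL2.equiv 𝕜 (fun _ : TSite d Pd => c₀) W).symm
    (fun y => ((c' * c) * ((∑ μ : Fin d, ((σ y - σ (unshift μ y)) - (σ (shift μ y) - σ y)) : ℝ) : 𝕜)) • l y) with hP1a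
  set P1b : SiteL2K 𝕜 d Pd c₀ W := (WL2.equiv 𝕜 (fun _ : TSite d Pd => c₀) W).symm
    (fun y => c' • ∑ μ : Fin d, ((σ (shift μ y) - σ y : ℝ) : 𝕜) • covDeriv c R l (y, μ)) with hP1b
  have hP1 : covDivL2K 𝕜 c₀ c' S adf = P1a - P1b := by
    apply (WL2.equiv 𝕜 (fun _ : TSite d Pd => c₀) W).injective
    funext y
    rw [equiv_covDivL2K, hadf_fun, WL2.equiv_sub, Pi.sub_apply, hP1a, hP1b, Equiv.apply_symm_apply, Equiv.apply_symm_apply]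
    have e := covDiv_comm_covDeriv_apply (fun x => (σ x : 𝕜)) c c' R S hSR l y
    rw [e]
    push_cast
    rw [smul_smul]
  -- ‖P1a‖ ≤ d‖c′‖‖c‖θ₂‖f‖ (a pointwise multiplier)
  have hκ : ∀ y : TSite d Pd, ‖((c' * c) * ((∑ μ : Fin d, ((σ y - σ (unshift μ y)) - (σ (shift μ y) - σ y)) : ℝ) : 𝕜))‖ ≤
      d * ‖c'‖ * ‖c‖ * θ₂ := by
    intro y
    rw [norm_mul, norm_mul, RCLike.norm_ofReal]
    have hs : |∑ μ : Fin d, ((σ y - σ (unshift μ y)) - (σ (shift μ y) - σ y))| ≤ d * θ₂ := by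
      calc _ ≤ ∑ μ : Fin d, |(σ y - σ (unshift μ y)) - (σ (shift μ y) - σ y)| := Finset.abs_sum_le_sum_abs _ _
        _ ≤ ∑ _μ : Fin d, θ₂ := Finset.sum_le_sum fun μ _ => h2 y μ
        _ = d * θ₂ := by simp
    calc ‖c'‖ * ‖c‖ * |∑ μ : Fin d, ((σ y - σ (unshift μ y)) - (σ (shift μ y) - σ y))| ≤ ‖c'‖ * ‖c‖ * (d * θ₂) :=
          mul_le_mul_of_nonneg_left hs (by positivity)
      _ = d * ‖c'‖ * ‖c‖ * θ₂ := by ring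
  have hP1a_le : ‖P1a‖ ≤ d * ‖c'‖ * ‖c‖ * θ₂ * ‖f‖ :=
    B9Eq311PointwiseMultipliers.norm_apply_le_of_pointwise (S := fun g : SiteL2K 𝕜 d Pd c₀ W =>
      (WL2.equiv 𝕜 (fun _ : TSite d Pd => c₀) W).symm (fun y => ((c' * c) * ((∑ μ : Fin d, ((σ y - σ (unshift μ y)) -
        (σ (shift μ y) - σ y)) : ℝ) : 𝕜)) • WL2.equiv 𝕜 _ W g y)) (fun g y => rfl) (by positivity) hκ f
  -- ‖P1b‖ ≤ √d‖c′‖θ₁‖Df‖ (out-star)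
  have hP1b_le : ‖P1b‖ ≤ Real.sqrt d * (‖c'‖ * θ₁) * ‖Df‖ := by
    refine norm_site_le_of_outstar_bound Df P1b (by positivity) fun y => ?_
    rw [hP1b, Equiv.apply_symm_apply, norm_smul, mul_assoc]
    refine mul_le_mul_of_nonneg_left ?_ (norm_nonneg _)
    rw [Finset.mul_sum]
    refine (norm_sum_le _ _).trans (Finset.sum_le_sum fun μ _ => ?_)
    rw [norm_smul, RCLike.norm_ofReal, hDf, equiv_covDerivL2K, ← hl]
    have h := h1 (y, μ)
    simp only [bpos, btgt] at h
    rw [abs_sub_comm] at h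
    exact mul_le_mul_of_nonneg_right h (norm_nonneg _)
  -- assemble
  rw [hsplit, hP1]
  calc ‖P1a - P1b - (Θ (covDivL2K 𝕜 c₀ c' S Df) - covDivL2K 𝕜 c₀ c' S (ΘB Df))‖
      ≤ ‖P1a‖ + ‖P1b‖ + ‖Θ (covDivL2K 𝕜 c₀ c' S Df) - covDivL2K 𝕜 c₀ c' S (ΘB Df)‖ :=
        (norm_sub_le _ _).trans (add_le_add (norm_sub_le _ _) le_rfl)
    _ ≤ d * ‖c'‖ * ‖c‖ * θ₂ * ‖f‖ + Real.sqrt d * (‖c'‖ * θ₁) * ‖Df‖ + Real.sqrt d * (‖c'‖ * θ₁ * MT) * ‖Df‖ :=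
        add_le_add (add_le_add hP1a_le hP1b_le) hP2
    _ = Real.sqrt d * ‖c'‖ * θ₁ * (MT + 1) * ‖Df‖ + d * ‖c'‖ * ‖c‖ * θ₂ * ‖f‖ := by ring

/-- **THE `η`-FREE READING**: at `c = c′ = η⁻¹` with first differences `≤ ℓη` and second differences `≤ ℓ₂η²`:
`‖D*(D(Θf)) − Θ(D*(Df))‖ ≤ √d·ℓ(M_T + 1)·‖Df‖ + d·ℓ₂·‖f‖` — `a₁ = √dℓ(M_T + 1)`, `a₀ = dℓ₂`, no `η`, no volume. [folklore] [cite: Balaban1985BackgroundPropagators, (3.88) p.409, p.413] -/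
theorem norm_lap_comm_le_etaFree {η ℓ ℓ₂ : ℝ} (hη : 0 < η) (hℓ : 0 ≤ ℓ) (hℓ₂ : 0 ≤ ℓ₂) (hMT : 0 ≤ MT)
    (hS : ∀ b v, ‖S b v‖ ≤ MT * ‖v‖) (hSR : ∀ b v, S b (R b v) = v) {σ : TSite d Pd → ℝ}
    (h1 : ∀ b : Bond d Pd, |σ (bpos b) - σ (btgt b)| ≤ ℓ * η)
    (h2 : ∀ (y : TSite d Pd) (μ : Fin d), |(σ y - σ (unshift μ y)) - (σ (shift μ y) - σ y)| ≤ ℓ₂ * η ^ 2)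
    (Θ : SiteL2K 𝕜 d Pd c₀ W → SiteL2K 𝕜 d Pd c₀ W) (ΘB : BondL2K 𝕜 d Pd c₀ W → BondL2K 𝕜 d Pd c₀ W)
    (hΘ : ∀ (f : SiteL2K 𝕜 d Pd c₀ W) (x : TSite d Pd), WL2.equiv 𝕜 _ W (Θ f) x = (σ x : 𝕜) • WL2.equiv 𝕜 _ W f x)
    (hΘB : ∀ (A : BondL2K 𝕜 d Pd c₀ W) (b : Bond d Pd), WL2.equiv 𝕜 _ W (ΘB A) b = (σ (bpos b) : 𝕜) • WL2.equiv 𝕜 _ W A b)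
    (f : SiteL2K 𝕜 d Pd c₀ W) :
    ‖covDivL2K 𝕜 c₀ ((η : 𝕜))⁻¹ S (covDerivL2K 𝕜 c₀ ((η : 𝕜))⁻¹ R (Θ f)) - Θ (covDivL2K 𝕜 c₀ ((η : 𝕜))⁻¹ S (covDerivL2K 𝕜 c₀ ((η : 𝕜))⁻¹ R f))‖ ≤
      Real.sqrt d * (ℓ * (MT + 1)) * ‖covDerivL2K 𝕜 c₀ ((η : 𝕜))⁻¹ R f‖ + d * ℓ₂ * ‖f‖ := by
  have hn : ‖((η : 𝕜))⁻¹‖ = η⁻¹ := by rw [norm_inv, RCLike.norm_ofReal, abs_of_pos hη]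
  have h := norm_lap_comm_le hMT hS hSR (by positivity) (by positivity) h1 h2 Θ ΘB hΘ hΘB ((η : 𝕜))⁻¹ ((η : 𝕜))⁻¹ f
  rw [hn] at h
  refine h.trans_eq ?_
  field_simp

end L2

/-! ## §3 The tree's cutoff profile: first and second difference letters of ONE cube function `hS_z` -/
section Profile
variable {d : ℕ} {Pd : Fin d → ℕ}

/-- the unit shift IS a coordinate update: `x + e_μ = update x μ (x_μ + 1)` (the chain's `shift` in `B5SmoothPartition`'s vocabulary). [folklore] -/
private theorem shift_eq_update [∀ i, NeZero (Pd i)] (μ : Fin d) (x : TSite d Pd) : shift μ x = Function.update x μ (x μ + 1) := by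
  unfold shift
  congr 1
  apply Fin.ext
  rw [Fin.val_add]
  simp [Nat.add_mod]

/-- two unit shifts: `x + 2e_μ = update x μ (x_μ + 1 + 1)`. [folklore] -/
private theorem shift_shift_eq_update [∀ i, NeZero (Pd i)] (μ : Fin d) (x : TSite d Pd) :
    shift μ (shift μ x) = Function.update x μ (x μ + 1 + 1) := by
  rw [shift_eq_update, shift_eq_update]
  simp [Function.update_idem, Function.update_self]

/-- **FIRST-DIFFERENCE LETTER OF ONE CUBE FUNCTION**: `|hS_z(x) − hS_z(x + e_μ)| ≤ 4∕M₀` (`1 ≤ M₀`) — `g^{(μ)}` is `4∕M₀`-Lipschitz in the circular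
distance, a unit step has circular length `≤ 1`, the other factors lie in `[0, 1]`. [folklore] [cite: Balaban1985BackgroundPropagators, (3.100) p.413 «O(M⁻¹)»] -/
theorem abs_hS_sub_shift_le [∀ i, NeZero (Pd i)] {M₀ : ℕ} (hM : 1 ≤ M₀) (z : Ctr Pd M₀) (x : TSite d Pd) (μ : Fin d) :
    |hS Pd M₀ z x - hS Pd M₀ z (shift μ x)| ≤ 4 / (M₀ : ℝ) := by
  have hP : ∀ i, 1 ≤ Pd i := fun i => NeZero.one_le
  rw [shift_eq_update, hS_update, hS_eq M₀ z x μ]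
  set R := ∏ i ∈ Finset.univ.erase μ, gS (Pd i) M₀ (z i) (x i) with hR
  have hR0 : 0 ≤ R := Finset.prod_nonneg fun i _ => gS_nonneg (hP i) M₀ (z i) (x i)
  have hR1 : R ≤ 1 := Finset.prod_le_one (fun i _ => gS_nonneg (hP i) M₀ (z i) (x i)) fun i _ => gS_le_one (z i) (x i)
  rw [← sub_mul, abs_mul, abs_of_nonneg hR0]
  have h1 := abs_gS_sub_le (hP μ) hM (z μ) (x μ) (x μ + 1)
  have hc : (circAbs (Pd μ) (((x μ).val : ℤ) - ((x μ + 1 : Fin (Pd μ)).val : ℤ)) : ℝ) ≤ 1 := by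
    have h := circAbs_bond_le_one μ (hP μ) x
    rwa [shift_eq_update, Function.update_self] at h
  calc |gS (Pd μ) M₀ (z μ) (x μ) - gS (Pd μ) M₀ (z μ) (x μ + 1)| * R ≤ (4 / (M₀ : ℝ) * 1) * 1 :=
        mul_le_mul (h1.trans (mul_le_mul_of_nonneg_left hc (by positivity))) hR1 hR0 (by positivity)
    _ = 4 / (M₀ : ℝ) := by ring

/-- the bond form: `|hS_z(b₋) − hS_z(b₊)| ≤ 4∕M₀` — the `h1` shape of `norm_lap_comm_le` with `θ₁ = 4∕M₀`. [folklore] [cite: Balaban1985BackgroundPropagators, (3.100) p.413] -/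
theorem abs_hS_bond_diff_le [∀ i, NeZero (Pd i)] {M₀ : ℕ} (hM : 1 ≤ M₀) (z : Ctr Pd M₀) (b : Bond d Pd) :
    |hS Pd M₀ z (bpos b) - hS Pd M₀ z (btgt b)| ≤ 4 / (M₀ : ℝ) :=
  abs_hS_sub_shift_le hM z b.1 b.2

/-- **SECOND-DIFFERENCE LETTER OF ONE CUBE FUNCTION, CENTRED FORM**: `|(hS_z(y) − hS_z(y − e_μ)) − (hS_z(y + e_μ) − hS_z(y))| ≤ 52∕M₀²` (`1 ≤ M₀`,
`2M₀ ≤ P_i`) — `B5SmoothPartition.abs_hS_second_diff_le` at `x = y − e_μ`: the `h2` shape of `norm_lap_comm_le`. [folklore] [cite: Balaban1985BackgroundPropagators, (3.100) p.413] -/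
theorem abs_hS_second_diff_centre_le [∀ i, NeZero (Pd i)] {M₀ : ℕ} (hM : 1 ≤ M₀) (h2N : ∀ i, 2 * M₀ ≤ Pd i) (z : Ctr Pd M₀)
    (y : TSite d Pd) (μ : Fin d) :
    |(hS Pd M₀ z y - hS Pd M₀ z (unshift μ y)) - (hS Pd M₀ z (shift μ y) - hS Pd M₀ z y)| ≤ 52 / (M₀ : ℝ) ^ 2 := by
  have h := abs_hS_second_diff_le hM h2N z (unshift μ y) μ
  rw [← shift_shift_eq_update, ← shift_eq_update, shift_unshift] at h
  rw [show (hS Pd M₀ z y - hS Pd M₀ z (unshift μ y)) - (hS Pd M₀ z (shift μ y) - hS Pd M₀ z y) =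
    -(hS Pd M₀ z (shift μ y) - 2 * hS Pd M₀ z y + hS Pd M₀ z (unshift μ y)) by ring, abs_neg]
  exact h

end Profile

/-! ## §4 The letters `a₁`, `a₀` AT THE TREE'S CUTOFF: `θ₁ = 4∕M₀`, `θ₂ = 52∕M₀²` -/
section Instance
variable {𝕜 : Type*} [RCLike 𝕜] {d : ℕ} {Pd : Fin d → ℕ} [∀ i, NeZero (Pd i)] {W : Type*} [NormedAddCommGroup W] [InnerProductSpace 𝕜 W]
  {c₀ : ℝ} [Fact (0 < c₀)] {R S : Bond d Pd → W →ₗ[𝕜] W} {MT : ℝ}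

/-- **`K(h_□)` FOR ONE CUBE OF THE TREE'S PARTITION**: `Θ`, `Θ_B` acting as multiplication by `hS_z` (`1 ≤ M₀`, `2M₀ ≤ P_i`), `‖S_b‖ ≤ M_T`, `S_b∘R_b = 1`,
any `c`, `c′`: `‖D*(D(Θf)) − Θ(D*(Df))‖ ≤ √d‖c′‖(4∕M₀)(M_T + 1)·‖Df‖ + d‖c′‖‖c‖(52∕M₀²)·‖f‖`. [folklore] [cite: Balaban1985BackgroundPropagators, (3.88) p.409, (3.100) p.413] -/
theorem norm_lap_comm_le_hS {M₀ : ℕ} (hM : 1 ≤ M₀) (h2N : ∀ i, 2 * M₀ ≤ Pd i) (z : Ctr Pd M₀) (hMT : 0 ≤ MT)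
    (hSb : ∀ b v, ‖S b v‖ ≤ MT * ‖v‖) (hSR : ∀ b v, S b (R b v) = v)
    (Θ : SiteL2K 𝕜 d Pd c₀ W → SiteL2K 𝕜 d Pd c₀ W) (ΘB : BondL2K 𝕜 d Pd c₀ W → BondL2K 𝕜 d Pd c₀ W)
    (hΘ : ∀ (f : SiteL2K 𝕜 d Pd c₀ W) (x : TSite d Pd), WL2.equiv 𝕜 _ W (Θ f) x = (hS Pd M₀ z x : 𝕜) • WL2.equiv 𝕜 _ W f x)
    (hΘB : ∀ (A : BondL2K 𝕜 d Pd c₀ W) (b : Bond d Pd), WL2.equiv 𝕜 _ W (ΘB A) b = (hS Pd M₀ z (bpos b) : 𝕜) • WL2.equiv 𝕜 _ W A b)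
    (c c' : 𝕜) (f : SiteL2K 𝕜 d Pd c₀ W) :
    ‖covDivL2K 𝕜 c₀ c' S (covDerivL2K 𝕜 c₀ c R (Θ f)) - Θ (covDivL2K 𝕜 c₀ c' S (covDerivL2K 𝕜 c₀ c R f))‖ ≤
      Real.sqrt d * ‖c'‖ * (4 / (M₀ : ℝ)) * (MT + 1) * ‖covDerivL2K 𝕜 c₀ c R f‖ + d * ‖c'‖ * ‖c‖ * (52 / (M₀ : ℝ) ^ 2) * ‖f‖ :=
  norm_lap_comm_le hMT hSb hSR (by positivity) (by positivity) (abs_hS_bond_diff_le hM z) (abs_hS_second_diff_centre_le hM h2N z) Θ ΘB hΘ hΘB c c' f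

/-- **THE LETTERS AT THE CHAIN'S SCALING `c = c′ = η⁻¹`**: `‖D*(D(Θf)) − Θ(D*(Df))‖ ≤ √d·(4∕(M₀η))·(M_T + 1)·‖Df‖ + d·(52∕(M₀η)²)·‖f‖` — `a₁ =
4√d(M_T + 1)∕(M₀η)`, `a₀ = 52d∕(M₀η)²`: «O(M⁻¹), or O(M⁻²) … on a proper scale» in the cube side `M = M₀η`; the `ha` hypothesis of
`B9Eq387CubeLocalisedProjection.norm_sub_projR_cube_le_nearfield` for `Δs := D*∘D`, `θ := hS_z·`. [folklore] [cite: Balaban1985BackgroundPropagators, (3.88) p.409, p.413] -/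
theorem norm_lap_comm_le_hS_eta {M₀ : ℕ} (hM : 1 ≤ M₀) (h2N : ∀ i, 2 * M₀ ≤ Pd i) (z : Ctr Pd M₀) {η : ℝ} (hη : 0 < η) (hMT : 0 ≤ MT)
    (hSb : ∀ b v, ‖S b v‖ ≤ MT * ‖v‖) (hSR : ∀ b v, S b (R b v) = v)
    (Θ : SiteL2K 𝕜 d Pd c₀ W → SiteL2K 𝕜 d Pd c₀ W) (ΘB : BondL2K 𝕜 d Pd c₀ W → BondL2K 𝕜 d Pd c₀ W)
    (hΘ : ∀ (f : SiteL2K 𝕜 d Pd c₀ W) (x : TSite d Pd), WL2.equiv 𝕜 _ W (Θ f) x = (hS Pd M₀ z x : 𝕜) • WL2.equiv 𝕜 _ W f x)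
    (hΘB : ∀ (A : BondL2K 𝕜 d Pd c₀ W) (b : Bond d Pd), WL2.equiv 𝕜 _ W (ΘB A) b = (hS Pd M₀ z (bpos b) : 𝕜) • WL2.equiv 𝕜 _ W A b)
    (f : SiteL2K 𝕜 d Pd c₀ W) :
    ‖covDivL2K 𝕜 c₀ ((η : 𝕜))⁻¹ S (covDerivL2K 𝕜 c₀ ((η : 𝕜))⁻¹ R (Θ f)) - Θ (covDivL2K 𝕜 c₀ ((η : 𝕜))⁻¹ S (covDerivL2K 𝕜 c₀ ((η : 𝕜))⁻¹ R f))‖ ≤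
      Real.sqrt d * (4 / ((M₀ : ℝ) * η)) * (MT + 1) * ‖covDerivL2K 𝕜 c₀ ((η : 𝕜))⁻¹ R f‖ + d * (52 / ((M₀ : ℝ) * η) ^ 2) * ‖f‖ := by
  have hM0 : (0 : ℝ) < (M₀ : ℝ) := by exact_mod_cast hM
  have hn : ‖((η : 𝕜))⁻¹‖ = η⁻¹ := by rw [norm_inv, RCLike.norm_ofReal, abs_of_pos hη]
  have h := norm_lap_comm_le_hS hM h2N z hMT hSb hSR Θ ΘB hΘ hΘB ((η : 𝕜))⁻¹ ((η : 𝕜))⁻¹ f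
  rw [hn] at h
  refine h.trans_eq ?_
  field_simp

end Instance

/-! ## §5 The letter `b₀` for the scalar averaging `Q′`: ONE pair of multipliers ((3.102) at a singleton family) -/
section Bzero
variable {d : ℕ} (L : ℕ) [NeZero L] (m : Fin d → ℕ) {W : Type*} [NormedAddCommGroup W] [InnerProductSpace ℂ W] {c₀ c₁ : ℝ}
  [Fact (0 < c₀)] [Fact (0 < c₁)] {Rb : Bond d (fineP L m) → W →ₗ[ℂ] W} {MA : ℝ}
  (hA : ∀ (y : TSite d m), ∀ x ∈ B9Eq319QprimeTorus.blockOf L m y, ∀ v : W,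
    ‖pathTr (stepTransport L m fun b => (Rb b).restrictScalars ℝ) (centre L m y :: contour L m x) v‖ ≤ MA * ‖v‖)
  (T : SiteL2K ℂ d (fineP L m) c₀ W → WL2 ℂ (fun _ : TSite d m => c₁) W)
  (hT : ∀ (f : SiteL2K ℂ d (fineP L m) c₀ W) (y : TSite d m),
    WL2.equiv ℂ (fun _ : TSite d m => c₁) W (T f) y = QprimeLin L m Rb (WL2.equiv ℂ (fun _ : TSite d (fineP L m) => c₀) W f) y)
  {χ' : TSite d m → ℝ} {χ : TSite d (fineP L m) → ℝ} {Θ : ℝ}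
  (hΘ : ∀ (y : TSite d m), ∀ x ∈ B9Eq319QprimeTorus.blockOf L m y, (χ' y - χ x) ^ 2 ≤ Θ)
  (χS : SiteL2K ℂ d (fineP L m) c₀ W → SiteL2K ℂ d (fineP L m) c₀ W)
  (χG : WL2 ℂ (fun _ : TSite d m => c₁) W → WL2 ℂ (fun _ : TSite d m => c₁) W)
  (hS : ∀ (f : SiteL2K ℂ d (fineP L m) c₀ W) (x : TSite d (fineP L m)),
    WL2.equiv ℂ (fun _ : TSite d (fineP L m) => c₀) W (χS f) x = (χ x : ℂ) • WL2.equiv ℂ (fun _ : TSite d (fineP L m) => c₀) W f x)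
  (hG : ∀ (g : WL2 ℂ (fun _ : TSite d m => c₁) W) (y : TSite d m),
    WL2.equiv ℂ (fun _ : TSite d m => c₁) W (χG g) y = (χ' y : ℂ) • WL2.equiv ℂ (fun _ : TSite d m => c₁) W g y)

include hA hT hΘ hS hG in
/-- **THE `b₀` SQUARE FOR ONE PAIR OF MULTIPLIERS AT `c₁ = L^dc₀`**: `χ_S` (fine, by `χ`), `χ_G` (coarse, by `χ′`), `(χ′(y) − χ(x))² ≤ Θ` on `x ∈ B(y)`,
transports `≤ M_A`, `T` acting as the scalar `Q̃′` (3.19): `‖χ_G(Tλ) − T(χ_Sλ)‖² ≤ M_A²Θ·‖λ‖²`. [folklore] [cite: Balaban1985BackgroundPropagators, (3.102) p.414, (3.19) p.393] -/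
theorem norm_sq_comm_T_single_le (hc : c₁ = (L : ℝ) ^ d * c₀) (f : SiteL2K ℂ d (fineP L m) c₀ W) :
    ‖χG (T f) - T (χS f)‖ ^ 2 ≤ MA ^ 2 * Θ * ‖f‖ ^ 2 := by
  have h := sum_norm_sq_comm_T_le_diagonal L m hA T hT (Finset.univ : Finset Unit) (χ' := fun _ => χ') (χ := fun _ => χ)
    (fun y x hx => by simpa using hΘ y x hx) (fun _ => χS) (fun _ => χG) (fun _ => hS) (fun _ => hG) hc f
  simpa using h

include hA hT hΘ hS hG in
/-- **THE LETTER `b₀ = M_A√Θ` — the `hb` hypothesis of `B9Eq387CubeLocalisedProjection.norm_sub_projR_cube_le_nearfield`** (`Q′ := T`, `θ := χ_S`,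
`θ_F := χ_G`): `‖T(χ_Sλ) − χ_G(Tλ)‖ ≤ M_A√Θ·‖λ‖` (`0 ≤ M_A`, `0 ≤ Θ`, `c₁ = L^dc₀`); for `χ = hS_z` sampled at block base points `Θ ≤ (4d(L − 1)∕M₀)²`
(`B5SmoothPartition.abs_hS_sub_le`) — «O(M⁻¹)». [folklore] [cite: Balaban1985BackgroundPropagators, (3.88) p.409, (3.102) p.414] -/
theorem norm_comm_T_single_le (hMA : 0 ≤ MA) (hΘ0 : 0 ≤ Θ) (hc : c₁ = (L : ℝ) ^ d * c₀) (f : SiteL2K ℂ d (fineP L m) c₀ W) :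
    ‖T (χS f) - χG (T f)‖ ≤ MA * Real.sqrt Θ * ‖f‖ := by
  rw [norm_sub_rev]
  have h := norm_sq_comm_T_single_le L m hA T hT hΘ χS χG hS hG hc f
  have h' : ‖χG (T f) - T (χS f)‖ ^ 2 ≤ (MA * Real.sqrt Θ * ‖f‖) ^ 2 := by
    rw [mul_pow, mul_pow, Real.sq_sqrt hΘ0]; exact h
  exact (pow_le_pow_iff_left₀ (norm_nonneg _) (by positivity) two_ne_zero).1 h'

include hA hT hS hG in
/-- **`b₀` AT THE TREE's CUTOFF**: ONE cube function `χ = hS_z` of `B5SmoothPartition` on the fine torus (`1 ≤ M₀`, `M₀ ∣ L·m_i`, `2M₀ ≤ L·m_i`), read on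
the coarse lattice at block base points `χ′(y) = hS_z(L·y)`: `‖T(χ_Sλ) − χ_G(Tλ)‖ ≤ M_A·2√d·(4(L − 1)∕M₀)·‖λ‖` (`b₀ = 8√dM_A(L − 1)∕M₀`; ONE term of
`B9Eq387IMSLocalLetterQprime.sum_hS_centre_sub_sq_le`). [folklore] [cite: Balaban1985BackgroundPropagators, (3.88) p.409, (3.102) p.414] -/
theorem norm_comm_T_single_le_hS {M₀ : ℕ} (hM : 1 ≤ M₀) (hdiv : ∀ i, M₀ ∣ fineP L m i) (h2N : ∀ i, 2 * M₀ ≤ fineP L m i)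
    (z : Ctr (fineP L m) M₀) (hχ : χ = B5SmoothPartition.hS (fineP L m) M₀ z) (hχ' : χ' = fun y => B5SmoothPartition.hS (fineP L m) M₀ z (centre L m y))
    (hMA : 0 ≤ MA) (hc : c₁ = (L : ℝ) ^ d * c₀) (f : SiteL2K ℂ d (fineP L m) c₀ W) :
    ‖T (χS f) - χG (T f)‖ ≤ MA * (2 * Real.sqrt d * (4 / (M₀ : ℝ) * ((L : ℝ) - 1))) * ‖f‖ := by
  have hL1 : (1 : ℝ) ≤ (L : ℝ) := by exact_mod_cast NeZero.one_le
  have hK : 0 ≤ 4 / (M₀ : ℝ) * ((L : ℝ) - 1) := mul_nonneg (by positivity) (sub_nonneg.2 hL1)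
  have hΘ' : ∀ (y : TSite d m), ∀ x ∈ B9Eq319QprimeTorus.blockOf L m y, (χ' y - χ x) ^ 2 ≤ 4 * (d : ℝ) * (4 / (M₀ : ℝ) * ((L : ℝ) - 1)) ^ 2 := by
    intro y x hx
    rw [hχ, hχ']
    exact (Finset.single_le_sum (f := fun z' : Ctr (fineP L m) M₀ => (B5SmoothPartition.hS (fineP L m) M₀ z' (centre L m y) - B5SmoothPartition.hS (fineP L m) M₀ z' x) ^ 2)
      (fun z' _ => sq_nonneg _) (Finset.mem_univ z)).trans (sum_hS_centre_sub_sq_le L m hM hdiv h2N y x hx)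
  have h := norm_comm_T_single_le L m hA T hT hΘ' χS χG hS hG hMA (by positivity) hc f
  have hsq : Real.sqrt (4 * (d : ℝ) * (4 / (M₀ : ℝ) * ((L : ℝ) - 1)) ^ 2) = 2 * Real.sqrt d * (4 / (M₀ : ℝ) * ((L : ℝ) - 1)) := by
    rw [Real.sqrt_mul (show (0 : ℝ) ≤ 4 * (d : ℝ) by positivity), Real.sqrt_sq hK, Real.sqrt_mul (show (0 : ℝ) ≤ 4 by norm_num),
      show Real.sqrt 4 = 2 by rw [show (4 : ℝ) = 2 ^ 2 by norm_num, Real.sqrt_sq (show (0 : ℝ) ≤ 2 by norm_num)]]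
  rwa [hsq] at h

end Bzero

end Literature.MathematicalPhysics.QuantumFieldTheory.Balaban1983to89.B9Eq388KhCommutatorLattice

end
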